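import Summits.BirchSwinnertonDyer.Rank1Residual.Additive.KatoDescentTorsionFreeReadings
import Summits.BirchSwinnertonDyer.Rank1Residual.Additive.N10IsogenyTransport
import HarnessLib

/-!
# The Kato descent WITHOUT (12.5.2) at a TORSION-FREE member, part (b): `KMC(T_pW)` (⊕ PR^× in rank
# one) ⇒ `BSD_p(W)` for `p ∤ #W(ℚ)_tors`, and ⇒ `BSD_p` of EVERY `ℚ`-isogenous curve (Cassels) — the
# X3 / small-image / CM rows of the additive potentially good cells (cell `bsd-potss`, seat `kmc`,
# generation 3; part 8b of the descent files; kernel assemblies over the readings of part 8a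
# `KatoDescentTorsionFreeReadings.lean`, nothing asserted)

HONEST FRAMING (cell `bsd-potss`, `run/shared/lean/pub/bsd-potss/`, FULL-BSD rank-`≤ 1` programme
tranche 1b, row B5 = O6 wild `3` incl. its X3 half (18 852 S-b pairs), rows B4/B8; typed against the
class shells of cell `b2b-bsdres` — `O6/O6Targets.lean` (`O6.X3WildOfKMC`), `O6/X3KatoMemberBound.lean`):
NOTHING about Kato's Main Conjecture or Perrin-Riou's conjecture is asserted and no Literature fact is
minted; every input is a displayed hypothesis — the image-free readings `TorsionFree.DescentCountReading`,
`TorsionFree.RankOneCountReading`, `TorsionFree.HasPRRatio`, `TorsionFree.RealizableOfKMC` (part 8a,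
where the printed derivation WITHOUT (12.5.2) is recorded: Conj. 12.10's own integrality clause + the
freeness of `𝐇¹(T)⁰` at `t_W = 0` replace Thm. 12.5 (4) — the algebra step "torsion-free `Λ`-module with
`ℤ_p`-free coinvariants is free" being the tree's `IwasawaAlgebra.free_of_coinvariants`
(`Literature/…/IwasawaAlgebraFreeOfCoinvariantsProofs.lean`); Prop. 14.16's display and Greenberg's
Prop. 4.13 are exact at `t_W = 0`), the interface lemma `ReadsTrivialKMC` (part 1), the interface `KMC`, the node
`PerrinRiouUpToUnitAt` (part 5), and the published facts Cassels (`bsdRHS_eq_of_isIsogenous`), GZK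
(`rank_eq_analyticRank_of_analyticRank_le_one`), modularity (`hasEntireLFunction_rat`). Census numbers are
not inputs; nothing is booked; no mark of `RESIDUAL-MAP.md` moves; X3 ∧ O6 stays OPEN.

## What is proved

* §4 AT A TORSION-FREE MEMBER (`p ≠ 2` additive potentially good, `p ∤ #W(ℚ)_tors`; ANY image, CM
  allowed): `TorsionFree.missingPPartAt_rankZero_of_kmc` (**KMC(T_pW) ⇒ BSD_p(W), r_an = 0** — Conj.
  12.10⁰ on the realised datum gives `[A : z] = #H²` by the tree's descent
  `KatoDescentDatum.zetaIndex_eq_h2Card_of_conj1210`, and Reading 1♭ turns that into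
  `ord_p #Ш = ord_p #Ш_an`); `TorsionFree.rankOne_missingPPartAt_of_kmc_of_perrinRiou` (**KMC ∧ PR^× ⇒
  BSD_p, r_an = 1** = Burns–Kurihara–Sano Thm. 7.6, whose Hyp. 2.2 (i) "`H¹(ℤ_S,T)` is `ℤ_p`-free" is
  exactly `t_W = 0`, NOT an image hypothesis); the combined `r_an ≤ 1` form; `BSDp`; KMC ⇒ Perrin-Riou's
  non-vanishing; KMC ∧ BSD_p ⇒ PR^× (BKS Thm. 7.3).
* §5 TRANSPORT (Cassels, the tree's `N10.bsdp_of_isIsogenous_of_bsdp`): **KMC (⊕ PR^×) at ONE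
  torsion-free member `W′` ⇒ `BSDp W p` and `MissingPPartAt W p` for EVERY globally minimal `W`
  isogenous to `W′`** — the X3 mechanism: a reducible `W[p]` usually comes with `p ∣ #W(ℚ)_tors`, but
  every X3 ∧ O6 class has a member with `3 ∤ #tors` (o6-r1 GEN 20 §0: 9 476 / 9 476, EVIDENCE; the
  class walk quotienting by the rational `3`-torsion terminates by Mazur–Kenku — not used: the member
  is a displayed witness). Consumer: `O6/X3WildOfKMCOfReadings.lean` (part 9).

WHAT THIS IS NOT. Not a proof of KMC or PR^× anywhere; no converse BSD_p ⇒ KMC off (12.5.2) (that needs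
the divisibility of Thm. 12.5 (4), replaced in the reducible case by o6-r1's theorem-candidate T-X3K
`O6.KatoMemberShaBoundOfReducible`, not used here); no construction of `𝐇^q(T)`, `z_γ`, `ℒ` (interfaces;
D-O6-2 stands); nothing at `p = 2`, nothing at a potentially multiplicative `p`; no claim at members
with `p ∣ #W(ℚ)_tors` except through an isogeny to a torsion-free member; nothing is booked.

References: K. Kato, Astérisque 295 (2004): Conj. 12.10 (p. 224), §14.14 and Lemma 14.15 (pp. 243–244),
Prop. 14.16 (2) (p. 244) [Kato2004Asterisque]; D. Burns, M. Kurihara, T. Sano, JMSJ 76 (2024) =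
arXiv:1910.07404, Hyp. 2.2 (p. 9), Conj. 2.8 (p. 10), Thm. 7.3, Thm. 7.6, Remark 7.7 (p. 29), Thm. 7.8 (d)
(p. 30) [BurnsKuriharaSano2019]; J. W. S. Cassels, J. reine angew. Math. 217 (1965)
[Cassels1965ArithmeticVIII]; A. W. Knapp, *Elliptic Curves* Thm. 11.67 [Knapp1993]; R. L. Miller, LMS JCM
14 (2011) §1, Def. 1.1 [Miller2011LMS].
-/

set_option autoImplicit false

noncomputable section

open scoped Classical

open WeierstrassCurve Literature.NumberTheory.EllipticCurves
  Literature.NumberTheory.EllipticCurves.ModularForms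
  Literature.NumberTheory.EllipticCurves.Rank1Residual
  Literature.NumberTheory.EllipticCurves.Rank1Residual.Typed
  Literature.NumberTheory.EllipticCurves.IwasawaAlgebra

namespace Summit.BirchSwinnertonDyer.Rank1Residual.Additive

namespace TorsionFree

/-! ## §4 THE DESCENT at a torsion-free member (kernel assemblies over the readings; nothing asserted) -/

section Descent

variable {IsOf : ∀ (W : WeierstrassCurve ℚ) [W.IsElliptic] [W.IsGloballyMinimal] (p : ℕ) [Fact p.Prime],
  KatoDescentDatum p → Prop}
variable {PRRatio : ∀ (W : WeierstrassCurve ℚ) [W.IsElliptic] [W.IsGloballyMinimal] (p : ℕ)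
  [Fact p.Prime], ℚ_[p] → Prop}
variable {KMC : ∀ (W : WeierstrassCurve ℚ) [W.IsElliptic] [W.IsGloballyMinimal] (p : ℕ), Prop}
variable (W : WeierstrassCurve ℚ) [W.IsElliptic] [W.IsGloballyMinimal] (p : ℕ) [Fact p.Prime]

omit [W.IsElliptic] [W.IsGloballyMinimal] in
/-- `ord_p #Ш(E)(p) = ord_p #Ш(E)`. [folklore] -/
private theorem padicValNat_primaryComponent_sha (hfin : Finite W.sha) :
    padicValNat p (Nat.card (AddCommGroup.primaryComponent W.sha p)) = padicValNat p W.shaOrder := by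
  haveI := hfin
  unfold WeierstrassCurve.shaOrder
  exact padicValNat_card_addPrimaryComponent p

/-- **Rank `0` at a TORSION-FREE member: `KMC(T_pW) ⇒ BSD_p(W)` (both halves) at an additive,
potentially good `p ≠ 2` with `p ∤ #W(ℚ)_tors` — NO image hypothesis** (X3 members without rational
`p`-torsion, non-surjective irreducible images, CM alike). Over Readings 1♭, 3♭ and the interface lemma:
KMC realises a datum (3♭) on which it reads as Conj. 12.10⁰ (`ReadsTrivialKMC`), the tree's descent
(`KatoDescentDatum.zetaIndex_eq_h2Card_of_conj1210`, Kato §14.14–14.15) gives `[A : z] = #H²`, and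
Reading 1♭ then says `ord_p #Ш + ord_p Tam = ord_p(L/Ω)`, i.e. `ord_p #Ш = ord_p #Ш_an` (`p ∤ #tors`).
[cite: Kato2004Asterisque, Conj. 12.10 (p. 224), §14.14 and Lemma 14.15 (pp. 243–244), Prop. 14.16 (2) (p. 244)] -/
theorem missingPPartAt_rankZero_of_kmc (hR : DescentCountReading IsOf)
    (hreal : RealizableOfKMC IsOf KMC) (hread : ReadsTrivialKMC IsOf KMC)
    (hGZK : rank_eq_analyticRank_of_analyticRank_le_one) (hmod : hasEntireLFunction_rat)
    (hr : W.analyticRank = 0) (hp : p ≠ 2) (hadd : Addv W p) (hj : 0 ≤ padicValRat p W.j)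
    (ht : ¬ p ∣ W.torsionOrder) (hKMC : KMC W p) : MissingPPartAt W p := by
  have hL : W.entireLFunction 1 ≠ 0 := (W.analyticRank_eq_zero_iff_holds (hmod W)).mp hr
  have hfin : Finite W.sha := (hGZK W (by rw [hr]; exact zero_le_one)).2
  obtain ⟨D, hDof⟩ := hreal W p hp hadd hj ht hKMC
  obtain ⟨hfinH2, q, hq, hcount⟩ := hR W p D hp hadd hj ht hL hfin hDof
  have hμ : D.zetaIndex = D.h2Card :=
    D.zetaIndex_eq_h2Card_of_conj1210 hfinH2 ((hread W p D hDof).mp hKMC)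
  rw [hμ] at hcount
  obtain ⟨q', hq', hv⟩ := exists_shaAn_eq_of_count W p hGZK hr hL ht hq hcount
  exact ⟨q', hq', by rw [hv]; ring⟩

/-- **Rank `0`, `BSD(E,p)` itself** (Miller's `BSDp`). [cite: Kato2004Asterisque, Conj. 12.10 (p. 224)] [cite: Miller2011LMS, Def. 1.1] -/
theorem bsdp_rankZero_of_kmc (hR : DescentCountReading IsOf)
    (hreal : RealizableOfKMC IsOf KMC) (hread : ReadsTrivialKMC IsOf KMC)
    (hGZK : rank_eq_analyticRank_of_analyticRank_le_one) (hmod : hasEntireLFunction_rat)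
    (hr : W.analyticRank = 0) (hp : p ≠ 2) (hadd : Addv W p) (hj : 0 ≤ padicValRat p W.j)
    (ht : ¬ p ∣ W.torsionOrder) (hKMC : KMC W p) : BSDp W p :=
  bsdp_of_missingPPartAt W p hGZK (by rw [hr]; exact zero_le_one)
    (missingPPartAt_rankZero_of_kmc W p hR hreal hread hGZK hmod hr hp hadd hj ht hKMC)

/-- **Rank ONE at a TORSION-FREE member: `KMC(T_pW) → PR^×(W) → BSD_p(W)` (both halves), NO image
hypothesis, NO `p`-adic height** — Burns–Kurihara–Sano Thm. 7.6 at `r = 1` "even in the case of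
additive reduction" (their Hyp. 2.2 (i) = `H¹(ℤ_S,T)` `ℤ_p`-free ⟸ `t_W = 0`; (ii),(iii) ⟸ `r_an = 1`
+ GZK), in Kato's `𝐇²`-formalism over Readings 1″♭, 3♭ and the interface lemma.
[cite: BurnsKuriharaSano2019, Thm. 7.6 and Remark 7.7 (p. 29), Hyp. 2.2 (p. 9)] [cite: Kato2004Asterisque, Conj. 12.10 (p. 224), §14.14 (p. 243)] -/
theorem rankOne_missingPPartAt_of_kmc_of_perrinRiou (hC : RankOneCountReading IsOf PRRatio)
    (hreal : RealizableOfKMC IsOf KMC) (hread : ReadsTrivialKMC IsOf KMC)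
    (hGZK : rank_eq_analyticRank_of_analyticRank_le_one) (hmod : hasEntireLFunction_rat)
    (hr : W.analyticRank = 1) (hp : p ≠ 2) (hadd : Addv W p) (hj : 0 ≤ padicValRat p W.j)
    (ht : ¬ p ∣ W.torsionOrder) (hPR : PerrinRiouUpToUnitAt PRRatio W p) (hKMC : KMC W p) :
    MissingPPartAt W p := by
  have hfin : Finite W.sha := (hGZK W (by rw [hr])).2
  obtain ⟨D, hDof⟩ := hreal W p hp hadd hj ht hKMC
  obtain ⟨ℒ, hℒ, -, q, hq, hv⟩ := hPR hr
  obtain ⟨hfinH2, -, hcount⟩ := hC W p D ℒ hr hp hadd hj ht hfin hDof hℒ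
  have hμ : D.zetaIndex = D.h2Card :=
    D.zetaIndex_eq_h2Card_of_conj1210 hfinH2 ((hread W p D hDof).mp hKMC)
  have hval := hcount 0 (by rw [pow_zero, one_mul]; exact hμ)
  obtain ⟨q', hq', hv'⟩ := exists_shaAn_eq_of_leadingTerm_eq W p ht
    (W.leadingLCoeff_ne_zero_holds (hmod W)) hq
  refine ⟨q', hq', ?_⟩
  rw [hv', ← hv, hval, padicValNat_primaryComponent_sha W p hfin]
  push_cast
  ring

/-- **Analytic rank `≤ 1` at a torsion-free member: `KMC(T_pW)`, plus PR^×(W) IF `r_an = 1`, ⇒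
`MissingPPartAt W p`** — the X3 slot's input shape. [cite: Kato2004Asterisque, Conj. 12.10 (p. 224)] [cite: BurnsKuriharaSano2019, Thm. 7.6 (p. 29)] -/
theorem missingPPartAt_of_kmc_of_perrinRiou (hR : DescentCountReading IsOf)
    (hC : RankOneCountReading IsOf PRRatio) (hreal : RealizableOfKMC IsOf KMC)
    (hread : ReadsTrivialKMC IsOf KMC) (hGZK : rank_eq_analyticRank_of_analyticRank_le_one)
    (hmod : hasEntireLFunction_rat) (hr : W.analyticRank ≤ 1) (hp : p ≠ 2) (hadd : Addv W p)
    (hj : 0 ≤ padicValRat p W.j) (ht : ¬ p ∣ W.torsionOrder)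
    (hPR : W.analyticRank = 1 → PerrinRiouUpToUnitAt PRRatio W p) (hKMC : KMC W p) :
    MissingPPartAt W p := by
  rcases Nat.le_one_iff_eq_zero_or_eq_one.mp hr with h0 | h1
  · exact missingPPartAt_rankZero_of_kmc W p hR hreal hread hGZK hmod h0 hp hadd hj ht hKMC
  · exact rankOne_missingPPartAt_of_kmc_of_perrinRiou W p hC hreal hread hGZK hmod h1 hp hadd hj ht
      (hPR h1) hKMC

/-- **… and `BSD(W,p)`** (Miller's `BSDp`). [cite: Kato2004Asterisque, Conj. 12.10 (p. 224)] [cite: Miller2011LMS, Def. 1.1] -/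
theorem bsdp_of_kmc_of_perrinRiou (hR : DescentCountReading IsOf)
    (hC : RankOneCountReading IsOf PRRatio) (hreal : RealizableOfKMC IsOf KMC)
    (hread : ReadsTrivialKMC IsOf KMC) (hGZK : rank_eq_analyticRank_of_analyticRank_le_one)
    (hmod : hasEntireLFunction_rat) (hr : W.analyticRank ≤ 1) (hp : p ≠ 2) (hadd : Addv W p)
    (hj : 0 ≤ padicValRat p W.j) (ht : ¬ p ∣ W.torsionOrder)
    (hPR : W.analyticRank = 1 → PerrinRiouUpToUnitAt PRRatio W p) (hKMC : KMC W p) : BSDp W p :=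
  bsdp_of_missingPPartAt W p hGZK hr
    (missingPPartAt_of_kmc_of_perrinRiou W p hR hC hreal hread hGZK hmod hr hp hadd hj ht hPR hKMC)

/-- **KMC ⇒ Perrin-Riou's NON-VANISHING at a torsion-free rank-one member** (`[A : z] = #H² ≠ 0`;
BKS Conj. 2.8 (i)). [cite: BurnsKuriharaSano2019, Conj. 2.8 (i) (p. 10)] [cite: Kato2004Asterisque, Conj. 12.10 (p. 224)] -/
theorem perrinRiou_nonvanishing_of_kmc (hC : RankOneCountReading IsOf PRRatio)
    (hreal : RealizableOfKMC IsOf KMC) (hread : ReadsTrivialKMC IsOf KMC)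
    (hGZK : rank_eq_analyticRank_of_analyticRank_le_one)
    (hr : W.analyticRank = 1) (hp : p ≠ 2) (hadd : Addv W p) (hj : 0 ≤ padicValRat p W.j)
    (ht : ¬ p ∣ W.torsionOrder) (hKMC : KMC W p) {ℒ : ℚ_[p]} (hℒ : PRRatio W p ℒ) : ℒ ≠ 0 := by
  have hfin : Finite W.sha := (hGZK W (by rw [hr])).2
  obtain ⟨D, hDof⟩ := hreal W p hp hadd hj ht hKMC
  obtain ⟨hfinH2, hiff, -⟩ := hC W p D ℒ hr hp hadd hj ht hfin hDof hℒ
  have hμ : D.zetaIndex = D.h2Card :=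
    D.zetaIndex_eq_h2Card_of_conj1210 hfinH2 ((hread W p D hDof).mp hKMC)
  exact hiff.mpr (by rw [hμ]; exact (D.h2Card_pos hfinH2).ne')

/-- **KMC ∧ BSD_p ⇒ PR^× at a torsion-free rank-one member** (Burns–Kurihara–Sano Thm. 7.3 at
`r = 1`: the Main Conjecture pins `z = u·(#Ш·Tam/#tors²)·log_ω(x)·x`). Over Readings 1″♭, 3♭, 4♭ and
the interface lemma. [cite: BurnsKuriharaSano2019, Thm. 7.3 (p. 29), Thm. 7.8 (d) (p. 30)] [cite: Kato2004Asterisque, Conj. 12.10 (p. 224)] -/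
theorem perrinRiouUpToUnitAt_of_kmc_of_missingPPartAt (hC : RankOneCountReading IsOf PRRatio)
    (hrat : HasPRRatio PRRatio) (hreal : RealizableOfKMC IsOf KMC) (hread : ReadsTrivialKMC IsOf KMC)
    (hGZK : rank_eq_analyticRank_of_analyticRank_le_one) (hmod : hasEntireLFunction_rat)
    (hr : W.analyticRank = 1) (hp : p ≠ 2) (hadd : Addv W p) (hj : 0 ≤ padicValRat p W.j)
    (ht : ¬ p ∣ W.torsionOrder) (hKMC : KMC W p) (hbsd : MissingPPartAt W p) :
    PerrinRiouUpToUnitAt PRRatio W p := by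
  intro _
  have hfin : Finite W.sha := (hGZK W (by rw [hr])).2
  obtain ⟨D, hDof⟩ := hreal W p hp hadd hj ht hKMC
  obtain ⟨ℒ, hℒ⟩ := hrat W p hr hp hadd hj ht
  obtain ⟨hfinH2, hiff, hcount⟩ := hC W p D ℒ hr hp hadd hj ht hfin hDof hℒ
  have hμ : D.zetaIndex = D.h2Card :=
    D.zetaIndex_eq_h2Card_of_conj1210 hfinH2 ((hread W p D hDof).mp hKMC)
  have hne : ℒ ≠ 0 := hiff.mpr (by rw [hμ]; exact (D.h2Card_pos hfinH2).ne')
  have hval := hcount 0 (by rw [pow_zero, one_mul]; exact hμ)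
  obtain ⟨q', hq', hv'⟩ := hbsd
  obtain ⟨q, hq, hvq⟩ := exists_leadingTerm_eq_of_shaAn_eq W p ht
    (W.leadingLCoeff_ne_zero_holds (hmod W)) hq'
  refine ⟨ℒ, hℒ, hne, q, hq, ?_⟩
  rw [hvq, hv', hval, padicValNat_primaryComponent_sha W p hfin]
  push_cast
  ring

end Descent

/-! ## §5 TRANSPORT: KMC (⊕ PR^×) at ONE torsion-free member gives `BSD_p` on the whole isogeny class -/

section Transport

variable {IsOf : ∀ (W : WeierstrassCurve ℚ) [W.IsElliptic] [W.IsGloballyMinimal] (p : ℕ) [Fact p.Prime],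
  KatoDescentDatum p → Prop}
variable {PRRatio : ∀ (W : WeierstrassCurve ℚ) [W.IsElliptic] [W.IsGloballyMinimal] (p : ℕ)
  [Fact p.Prime], ℚ_[p] → Prop}
variable {KMC : ∀ (W : WeierstrassCurve ℚ) [W.IsElliptic] [W.IsGloballyMinimal] (p : ℕ), Prop}

/-- **`BSD(W,p)` for EVERY globally minimal `W` isogenous to a torsion-free member `W′` at which KMC
(and PR^× if `r_an = 1`) is granted**, `p ≠ 2` additive potentially good at `W′`: the descent of §4
at `W′`, then Cassels' isogeny invariance of Miller's `BSD(E,p)` in analytic rank `≤ 1`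
(the tree's `N10.bsdp_of_isIsogenous_of_bsdp` = Wuthrich2014's `bsdp_of_isIsogenous` with the cell's binders; the analytic ranks of `W`, `W′` agree, Knapp 11.67).
Binders of `W′` displayed (additivity and potential good reduction ARE isogeny-invariant, but the tree
transports only good reduction — `IsIsogenous.hasGoodReductionAtPrime_iff` — so they are carried).
[cite: Cassels1965ArithmeticVIII] [cite: Miller2011LMS, §1 and Def. 1.1] [cite: Kato2004Asterisque, Conj. 12.10 (p. 224)]
[cite: BurnsKuriharaSano2019, Thm. 7.6 (p. 29)] -/
theorem bsdp_of_isIsogenous_of_kmc (hR : DescentCountReading IsOf)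
    (hC : RankOneCountReading IsOf PRRatio) (hreal : RealizableOfKMC IsOf KMC)
    (hread : ReadsTrivialKMC IsOf KMC) (hCassels : bsdRHS_eq_of_isIsogenous)
    (hGZK : rank_eq_analyticRank_of_analyticRank_le_one) (hmod : hasEntireLFunction_rat)
    (W W' : WeierstrassCurve ℚ) [W.IsElliptic] [W.IsGloballyMinimal] [W'.IsElliptic]
    [W'.IsGloballyMinimal] (p : ℕ) [Fact p.Prime] (hiso : IsIsogenous W W')
    (hr : W.analyticRank ≤ 1) (hp : p ≠ 2) (hadd' : Addv W' p) (hj' : 0 ≤ padicValRat p W'.j)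
    (ht' : ¬ p ∣ W'.torsionOrder) (hPR' : W'.analyticRank = 1 → PerrinRiouUpToUnitAt PRRatio W' p)
    (hKMC' : KMC W' p) : BSDp W p := by
  have hr' : W'.analyticRank ≤ 1 := by rw [← analyticRank_eq_of_isIsogenous' hiso]; exact hr
  exact N10.bsdp_of_isIsogenous_of_bsdp p hCassels hGZK hmod hiso hr
    (bsdp_of_kmc_of_perrinRiou W' p hR hC hreal hread hGZK hmod hr' hp hadd' hj' ht' hPR' hKMC')

/-- **… in `MissingPPartAt` currency** (the X3 slot's conclusion).
[cite: Cassels1965ArithmeticVIII] [cite: Miller2011LMS, §1 and Def. 1.1] -/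
theorem missingPPartAt_of_isIsogenous_of_kmc (hR : DescentCountReading IsOf)
    (hC : RankOneCountReading IsOf PRRatio) (hreal : RealizableOfKMC IsOf KMC)
    (hread : ReadsTrivialKMC IsOf KMC) (hCassels : bsdRHS_eq_of_isIsogenous)
    (hGZK : rank_eq_analyticRank_of_analyticRank_le_one) (hmod : hasEntireLFunction_rat)
    (W W' : WeierstrassCurve ℚ) [W.IsElliptic] [W.IsGloballyMinimal] [W'.IsElliptic]
    [W'.IsGloballyMinimal] (p : ℕ) [Fact p.Prime] (hiso : IsIsogenous W W')
    (hr : W.analyticRank ≤ 1) (hp : p ≠ 2) (hadd' : Addv W' p) (hj' : 0 ≤ padicValRat p W'.j)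
    (ht' : ¬ p ∣ W'.torsionOrder) (hPR' : W'.analyticRank = 1 → PerrinRiouUpToUnitAt PRRatio W' p)
    (hKMC' : KMC W' p) : MissingPPartAt W p := by
  haveI : Finite W.sha := (hGZK W hr).2
  exact missingPPartAt_of_bsdp W p (bsdp_of_isIsogenous_of_kmc hR hC hreal hread hCassels hGZK hmod
    W W' p hiso hr hp hadd' hj' ht' hPR' hKMC')

/-- **Rank `0` only (no PR^× anywhere): KMC at one torsion-free member ⇒ `BSD(W,p)` on the class.**
[cite: Cassels1965ArithmeticVIII] [cite: Kato2004Asterisque, Conj. 12.10 (p. 224)] [cite: Miller2011LMS, Def. 1.1] -/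
theorem bsdp_rankZero_of_isIsogenous_of_kmc (hR : DescentCountReading IsOf)
    (hreal : RealizableOfKMC IsOf KMC) (hread : ReadsTrivialKMC IsOf KMC)
    (hCassels : bsdRHS_eq_of_isIsogenous) (hGZK : rank_eq_analyticRank_of_analyticRank_le_one)
    (hmod : hasEntireLFunction_rat)
    (W W' : WeierstrassCurve ℚ) [W.IsElliptic] [W.IsGloballyMinimal] [W'.IsElliptic]
    [W'.IsGloballyMinimal] (p : ℕ) [Fact p.Prime] (hiso : IsIsogenous W W')
    (hr : W.analyticRank = 0) (hp : p ≠ 2) (hadd' : Addv W' p) (hj' : 0 ≤ padicValRat p W'.j)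
    (ht' : ¬ p ∣ W'.torsionOrder) (hKMC' : KMC W' p) : BSDp W p := by
  have hr' : W'.analyticRank = 0 := by rw [← analyticRank_eq_of_isIsogenous' hiso]; exact hr
  exact N10.bsdp_of_isIsogenous_of_bsdp p hCassels hGZK hmod hiso (by rw [hr]; exact zero_le_one)
    (bsdp_rankZero_of_kmc W' p hR hreal hread hGZK hmod hr' hp hadd' hj' ht' hKMC')

end Transport

end TorsionFree

end Summit.BirchSwinnertonDyer.Rank1Residual.Additive

end
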